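import Summits.SmoothPoincare4.SmoothPoincare4.Theorems.SblfDescentRungOneHelperBottFieldLocal
import Mathlib.Geometry.Manifold.BumpFunction
import Mathlib.Geometry.Manifold.Instances.Sphere
import Mathlib.Geometry.Manifold.IntegralCurve.Basic
import Mathlib.Analysis.Calculus.MeanValue
import HarnessLib

/-!
# Manifold generalities for the transported torus coordinate (layer T of brick F3, part 2)

Auxiliary file (layer T.2) of the registered layer `helper_f3_transport` of stub
`helper_sliceGluing_bottConstruction` (apex brick F3), line `Sketch`, crux `SblfDescent.RungOne`.

(Crux item stmt-SmoothPoincare4-18531; skeleton `Cruxes/RungOne/Lines/Sketch.lean`.)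

Three pieces of general differential topology used by the transport:

* `F3T.exists_local_lift_on` — **local lifts through a map smooth on an open set**: the tree's
  `Literature.Geometry.Manifold.exists_local_lift_of_surjective_mfderiv` (Bröcker–Jänich 1982,
  proof of (8.12): a vector field `W` with `dg(W) = c` near a point where `dg` is onto) asks for
  a globally smooth `g`; multiplying by a smooth bump function reduces the locally smooth case
  to it;
* `F3T.apply_integralCurve_eq_add_smul` — **first integrals, local form**: along an integral
  curve `γ` of `V`, a vector-valued `g` smooth on an open set containing `γ([a, b])` with
  `dg(V) = c` there satisfies `g (γ b) = g (γ a) + (b - a) c` (mean value theorem; Milnor 1963,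
  proof of Thm. 3.1, "`f(φ_t(q)) = f(q) + t`");
* sphere-valued maps: `mfderiv` of `x ↦ (a x : E)` is `d(coe) ∘ da` (`F3T.mfderiv_coe_comp_sphere`),
  so `da w = 0 ↔ d(coe ∘ a) w = 0` (Mathlib's `mfderiv_coe_sphere_injective`), and a map into a
  sphere which is smooth as an `E`-valued map on an open set is smooth into the sphere there
  (`F3T.contMDiffOn_sphere_of_coe`, Mathlib's `ContMDiff.codRestrict_sphere` on the open
  submanifold).

## References

* Th. Bröcker, K. Jänich, *Introduction to Differential Topology*, CUP 1982, (8.12) (proof).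
  [BrockerJanichIDT1982]
* J. Milnor, *Morse theory*, Ann. of Math. Studies 51 (1963), proof of Thm. 3.1. [Milnor1963]
-/

set_option linter.dupNamespace false

noncomputable section

open scoped Manifold ContDiff Topology
open Set Function Filter

namespace Summit.SmoothPoincare4.SmoothPoincare4.Cruxes.RungOne.Sketch

namespace F3T

/-! ### Local lifts through a locally smooth map -/

section Lift

variable {EN : Type*} [NormedAddCommGroup EN] [NormedSpace ℝ EN] [FiniteDimensional ℝ EN]
  {H : Type*} [TopologicalSpace H] {I : ModelWithCorners ℝ EN H} [I.Boundaryless]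
  {N : Type*} [TopologicalSpace N] [ChartedSpace H N] [IsManifold I ∞ N] [T2Space N]
  {F : Type*} [NormedAddCommGroup F] [NormedSpace ℝ F] [FiniteDimensional ℝ F]

-- the fibres of the tangent bundle are the model vector space by definition
set_option backward.isDefEq.respectTransparency false in
/-- **Local lifts through a map smooth on an open set** (Bröcker–Jänich 1982, proof of (8.12)):
if `g` is `C^∞` on an open `O ∋ x₀` into a finite-dimensional space with `dg(x₀)` onto, then for
every `c` there is a neighbourhood `U ⊆ O` of `x₀` and a vector field `W`, `C^∞` on `U`, with
`dg(W x) = c` for `x ∈ U`. [cite: BrockerJanichIDT1982, (8.12) (proof, local lifts)] -/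
theorem exists_local_lift_on {g : N → F} {O : Set N} (hO : IsOpen O)
    (hg : ContMDiffOn I 𝓘(ℝ, F) ∞ g O) {x₀ : N} (hx₀ : x₀ ∈ O)
    (hsurj : Surjective (mfderiv I 𝓘(ℝ, F) g x₀)) (c : F) :
    ∃ U ∈ 𝓝 x₀, U ⊆ O ∧ ∃ W : Π x : N, TangentSpace I x,
      ContMDiffOn I I.tangent ∞ (fun x => (⟨x, W x⟩ : TangentBundle I N)) U ∧
      ∀ x ∈ U, mfderiv I 𝓘(ℝ, F) g x (W x) = c := by
  -- a bump function supported in `O`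
  obtain ⟨φ, -, hφO⟩ := (SmoothBumpFunction.nhds_basis_tsupport (I := I) x₀).mem_iff.1 (hO.mem_nhds hx₀)
  set g₁ : N → F := fun x => φ x • g x with hg₁
  have hg₁s : ContMDiff I 𝓘(ℝ, F) ∞ g₁ := by
    refine contMDiff_of_tsupport fun x hx => ?_
    have hxO : x ∈ O := hφO (tsupport_smul_subset_left _ _ hx)
    exact φ.contMDiff.contMDiffAt.smul (hg.contMDiffAt (hO.mem_nhds hxO))
  -- `g₁ = g` on the open set where `φ = 1`
  obtain ⟨S, hSφ, hSo, hx₀S⟩ := eventually_nhds_iff.1 (φ.eventuallyEq_one : φ =ᶠ[𝓝 x₀] 1)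
  have hSO : S ⊆ O := fun x hx =>
    hφO (subset_tsupport _ (by rw [mem_support, hSφ x hx]; exact one_ne_zero))
  have heq : ∀ x ∈ S, g₁ =ᶠ[𝓝 x] g := fun x hx => by
    filter_upwards [hSo.mem_nhds hx] with y hy
    show φ y • g y = g y
    rw [hSφ y hy, Pi.one_apply, one_smul]
  have hmf : ∀ x ∈ S, mfderiv I 𝓘(ℝ, F) g₁ x = mfderiv I 𝓘(ℝ, F) g x := fun x hx => (heq x hx).mfderiv_eq
  have hsurj₁ : Surjective (mfderiv I 𝓘(ℝ, F) g₁ x₀) := by rw [hmf x₀ hx₀S]; exact hsurj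
  obtain ⟨U₁, hU₁, W, hWs, hW⟩ :=
    Literature.Geometry.Manifold.exists_local_lift_of_surjective_mfderiv hg₁s hsurj₁ c
  refine ⟨U₁ ∩ S, inter_mem hU₁ (hSo.mem_nhds hx₀S), fun x hx => hSO hx.2, W,
    hWs.mono inter_subset_left, fun x hx => ?_⟩
  rw [← hmf x hx.2]
  exact hW x hx.1

end Lift

/-! ### First integrals along integral curves, local form -/

section FirstIntegral

variable {E : Type*} [NormedAddCommGroup E] [NormedSpace ℝ E] {H : Type*} [TopologicalSpace H]
  {I : ModelWithCorners ℝ E H} {M : Type*} [TopologicalSpace M] [ChartedSpace H M]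
  {E' : Type*} [NormedAddCommGroup E'] [NormedSpace ℝ E']

/-- Along an integral curve `γ` of `V`, a vector-valued `g` differentiable at `γ t` has
`(g ∘ γ)' (t) = dg(V (γ t))`. [folklore] -/
theorem hasDerivAt_comp_of_isMIntegralCurve {γ : ℝ → M} {V : Π x : M, TangentSpace I x}
    (hγ : IsMIntegralCurve γ V) {g : M → E'} {t : ℝ}
    (hg : MDifferentiableAt I 𝓘(ℝ, E') g (γ t)) :
    HasDerivAt (g ∘ γ) (mfderiv I 𝓘(ℝ, E') g (γ t) (V (γ t))) t := by
  have h1 : HasMFDerivAt 𝓘(ℝ, ℝ) 𝓘(ℝ, E') (g ∘ γ) t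
      ((mfderiv I 𝓘(ℝ, E') g (γ t)).comp ((1 : ℝ →L[ℝ] ℝ).smulRight (V (γ t)))) :=
    hg.hasMFDerivAt.comp t (hγ t)
  have h2 : HasFDerivAt (g ∘ γ)
      ((mfderiv I 𝓘(ℝ, E') g (γ t)).comp ((1 : ℝ →L[ℝ] ℝ).smulRight (V (γ t)))) t :=
    hasMFDerivAt_iff_hasFDerivAt.1 h1
  have h3 : ((mfderiv I 𝓘(ℝ, E') g (γ t)).comp ((1 : ℝ →L[ℝ] ℝ).smulRight (V (γ t))) :
      ℝ →L[ℝ] E') = (1 : ℝ →L[ℝ] ℝ).smulRight (mfderiv I 𝓘(ℝ, E') g (γ t) (V (γ t))) := by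
    apply ContinuousLinearMap.ext_ring
    simp
  exact hasDerivAt_iff_hasFDerivAt.2 (h2.congr_fderiv h3)

/-- **First integrals, local form** (Milnor 1963, proof of Thm. 3.1: along the flow of a field
`X` with `X(f) = 1`, `f (φ_t q) = f q + t`): if `γ` is an integral curve of `V`, `g` is `C¹` on
an open `O ⊇ γ([a, b])`, and `dg(V (γ s)) = c` for `s ∈ [a, b]`, then
`g (γ b) = g (γ a) + (b - a) • c`. [cite: Milnor1963, proof of Thm. 3.1] -/
theorem apply_integralCurve_eq_add_smul {γ : ℝ → M} {V : Π x : M, TangentSpace I x}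
    (hγ : IsMIntegralCurve γ V) {g : M → E'} {O : Set M} (hO : IsOpen O)
    (hg : ∀ x ∈ O, MDifferentiableAt I 𝓘(ℝ, E') g x) {a b : ℝ} (hab : a ≤ b)
    (hγO : ∀ s ∈ Icc a b, γ s ∈ O) {c : E'}
    (hc : ∀ s ∈ Icc a b, mfderiv I 𝓘(ℝ, E') g (γ s) (V (γ s)) = c) :
    g (γ b) = g (γ a) + (b - a) • c := by
  have _ := hO
  set ψ : ℝ → E' := fun s => g (γ s) - (s - a) • c with hψ
  have hder : ∀ s ∈ Icc a b, HasDerivAt ψ 0 s := fun s hs => by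
    have h1 : HasDerivAt (g ∘ γ) c s := by
      rw [← hc s hs]; exact hasDerivAt_comp_of_isMIntegralCurve hγ (hg _ (hγO s hs))
    have h2 : HasDerivAt (fun s : ℝ => (s - a) • c) ((1 : ℝ) • c) s :=
      ((hasDerivAt_id s).sub_const a).smul_const c
    have h3 := h1.sub h2
    rw [one_smul, sub_self] at h3
    exact h3
  have hcont : ContinuousOn ψ (Icc a b) := fun s hs => (hder s hs).continuousAt.continuousWithinAt
  have hconst := constant_of_has_deriv_right_zero hcont
    (fun s hs => (hder s ⟨hs.1, hs.2.le⟩).hasDerivWithinAt) b (right_mem_Icc.2 hab)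
  simp only [hψ, sub_self, zero_smul, sub_zero] at hconst
  rw [← hconst]; abel

end FirstIntegral

/-! ### Maps into spheres -/

section Sphere

variable {E : Type*} [NormedAddCommGroup E] [NormedSpace ℝ E] {H : Type*} [TopologicalSpace H]
  {I : ModelWithCorners ℝ E H} {M : Type*} [TopologicalSpace M] [ChartedSpace H M]
  {EE : Type*} [NormedAddCommGroup EE] [InnerProductSpace ℝ EE] {n : ℕ}
  [Fact (Module.finrank ℝ EE = n + 1)]

/-- **Chain rule through the inclusion of the sphere**: for `a : M → 𝕊ⁿ` differentiable at `x`,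
`d(coe ∘ a)(x) w = d(coe)(a x) (da(x) w)`. [folklore] -/
theorem mfderiv_coe_comp_sphere {a : M → Metric.sphere (0 : EE) 1} {x : M}
    (ha : MDifferentiableAt I (𝓡 n) a x) (w : TangentSpace I x) :
    mfderiv I 𝓘(ℝ, EE) (fun y => (a y : EE)) x w =
      mfderiv (𝓡 n) 𝓘(ℝ, EE) (Subtype.val : Metric.sphere (0 : EE) 1 → EE) (a x)
        (mfderiv I (𝓡 n) a x w) := by
  have hc : MDifferentiableAt (𝓡 n) 𝓘(ℝ, EE) (Subtype.val : Metric.sphere (0 : EE) 1 → EE) (a x) :=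
    (contMDiff_coe_sphere (E := EE) (m := ∞) (n := n)).mdifferentiableAt (by simp)
  have h := mfderiv_comp x hc ha
  exact congrArg (fun L : TangentSpace I x →L[ℝ] EE => L w) h

/-- For a sphere-valued map, `da(x) w = 0 ↔ d(coe ∘ a)(x) w = 0` (the inclusion is an
immersion, Mathlib's `mfderiv_coe_sphere_injective`). [folklore] -/
theorem mfderiv_sphere_apply_eq_zero_iff {a : M → Metric.sphere (0 : EE) 1} {x : M}
    (ha : MDifferentiableAt I (𝓡 n) a x) (w : TangentSpace I x) :
    mfderiv I (𝓡 n) a x w = 0 ↔ mfderiv I 𝓘(ℝ, EE) (fun y => (a y : EE)) x w = 0 := by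
  rw [mfderiv_coe_comp_sphere ha]
  constructor
  · intro h; rw [h, map_zero]
  · intro h
    have h' : mfderiv (𝓡 n) 𝓘(ℝ, EE) (Subtype.val : Metric.sphere (0 : EE) 1 → EE) (a x)
        (mfderiv I (𝓡 n) a x w) = mfderiv (𝓡 n) 𝓘(ℝ, EE) (Subtype.val : Metric.sphere (0 : EE) 1 → EE) (a x) 0 := by
      rw [h, map_zero]
    exact mfderiv_coe_sphere_injective (n := n) (a x) h'

variable [IsManifold I ∞ M]

/-- **A map into a sphere which is smooth as an `E`-valued map on an open set is smooth into the
sphere there** (`ContMDiff.codRestrict_sphere` on the open submanifold). [folklore] -/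
theorem contMDiffOn_sphere_of_coe {a : M → Metric.sphere (0 : EE) 1} {s : Set M}
    (hs : IsOpen s) (ha : ContMDiffOn I 𝓘(ℝ, EE) ∞ (fun x => (a x : EE)) s) :
    ContMDiffOn I (𝓡 n) ∞ a s := by
  intro x hx
  set U : TopologicalSpace.Opens M := ⟨s, hs⟩ with hU
  have h1 : ContMDiff I 𝓘(ℝ, EE) ∞ (fun y : U => (a y : EE)) := fun y =>
    (contMDiffAt_subtype_iff (U := U) (f := fun x => (a x : EE))).2
      ((ha y y.2).contMDiffAt (hs.mem_nhds y.2))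
  have h2 : ContMDiff I (𝓡 n) ∞ (Set.codRestrict (fun y : U => (a y : EE)) (Metric.sphere (0 : EE) 1)
      fun y => (a y).2) := h1.codRestrict_sphere _
  have h3 : (Set.codRestrict (fun y : U => (a y : EE)) (Metric.sphere (0 : EE) 1) fun y => (a y).2) =
      fun y : U => a y := by
    funext y; ext1; rfl
  rw [h3] at h2
  have h4 := (contMDiffAt_subtype_iff (U := U) (f := a) (x := ⟨x, hx⟩)).1 (h2 ⟨x, hx⟩)
  exact h4.contMDiffWithinAt

end Sphere

/-! ### Chain rule with a function of a vector variable -/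

section Chain

variable {E : Type*} [NormedAddCommGroup E] [NormedSpace ℝ E] {H : Type*} [TopologicalSpace H]
  {I : ModelWithCorners ℝ E H} {M : Type*} [TopologicalSpace M] [ChartedSpace H M]
  {V V' : Type*} [NormedAddCommGroup V] [NormedSpace ℝ V] [NormedAddCommGroup V'] [NormedSpace ℝ V']

/-- `d(φ ∘ g)(x) w = Dφ(g x) (dg(x) w)` for `φ` differentiable at `g x`. [folklore] -/
theorem mfderiv_comp_apply_of_differentiableAt {g : M → V} {x : M}
    (hg : MDifferentiableAt I 𝓘(ℝ, V) g x) {φ : V → V'} (hφ : DifferentiableAt ℝ φ (g x))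
    (w : TangentSpace I x) :
    mfderiv I 𝓘(ℝ, V') (fun y => φ (g y)) x w = fderiv ℝ φ (g x) (mfderiv I 𝓘(ℝ, V) g x w) := by
  have h := (BottField.hasMFDerivAt_comp_of_hasFDerivAt hφ.hasFDerivAt hg.hasMFDerivAt).mfderiv
  exact congrArg (fun L : TangentSpace I x →L[ℝ] V' => L w) h

/-- `d(L ∘ g)(x) w = L (dg(x) w)` for a continuous linear `L`. [folklore] -/
theorem mfderiv_clm_comp_apply {g : M → V} {x : M} (hg : MDifferentiableAt I 𝓘(ℝ, V) g x)
    (L : V →L[ℝ] V') (w : TangentSpace I x) :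
    mfderiv I 𝓘(ℝ, V') (fun y => L (g y)) x w = L (mfderiv I 𝓘(ℝ, V) g x w) := by
  have h := (BottField.hasMFDerivAt_clm_apply L hg.hasMFDerivAt).mfderiv
  exact congrArg (fun L : TangentSpace I x →L[ℝ] V' => L w) h

end Chain

end F3T

end Summit.SmoothPoincare4.SmoothPoincare4.Cruxes.RungOne.Sketch

end
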